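import Mathlib

/-!
# Block-margin certificate checker — definitions, part 1 (crux stmt-QuantumFields-9734, line `Sketch`, lead c3)

What. The pointwise block-margin inequalities `P0–P3a` (`stub_blockMargin0..3a` of `Lines/Sketch.lean`) reduce,
by the landed `stub_blockReduction` and `stub_blockClosedForm`, to: for every block twist `C = cos θ` of a region
and every Walsh class `s`, the real symmetric matrix `(blockHc C s μ ν)_{μ,ν active}` satisfies
`yᵀ H y ≥ 64 γ n(s) |y|²` on `1^⊥` (`BlockMargin γ C s`). This file holds the DEFINITIONS of the kernel/native-evaluable
certificate checker proving such statements on boxes of `C`: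

* `sgn`, `s2`, `aW`, `hW`, `wS`, `tB`, `blockHc` — the REAL CLOSED FORM of the block-Hessian entries (a rational
  function of `C` alone; tadpole `[μ=ν] Σ_σ 2(S2_μ − A(σ)σ_μC_μ)/h(σ)` plus bubble `Σ_σ 2T/(h(σ)h(σ+s))`), `nAct`,
  `BlockMargin`; the symmetries `reflectC` (sign flips), `permC` (relabelling), `absPattern`;
* `bitsFun`, `actList` — Walsh classes as bit masks;
* `ldlPos`, `midM`, `radM`, `rowR`, `XM`, `GM`, `blockOK` — the exact-rational per-block test
  `Pᵀ(Hmid − 64nγ − diag R)P ≻ 0` (`LDLᵀ` pivots; `P` spans `1^⊥`) from entrywise enclosures;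
* `IBox` (integer boxes `lo_k ≤ C_k·S ≤ hi_k`), `IBox.split`, `IBox.outsideSorted` (the box misses the chamber
  `C₀ ≤ C₁ ≤ C₂ ≤ C₃`), and the fuel-bounded adaptive bisection `certify leafOK fuel B`, generic in the leaf test;
* `nNear`, `InRegion` — the four regions in `C`-coordinates; `SC = 2²⁰`, `K0`, `K0m`, `K2`, `roots` — scale,
  rational thresholds (`0.8783 ≥ cos ½ ≥ 0.8717`, `0.99875033 ≥ cos (1/20)`) and the root boxes per region in the
  sorted nonnegative chamber.

Soundness: `…CheckerSound.lean` (block test, bisection), `…CheckerSymm.lean` (symmetries, chamber reduction, root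
coverage); the affine-arithmetic leaf test: `…CheckerEvalDefs.lean` and its soundness files; certificates:
`…CheckerCert*.lean`. Design: every `def` here is total and computable except the real-valued ones; no facts, no axioms.
-/

namespace Summit.QuantumFields.QCD.Cruxes.CriticalLineDiamagnetism.ChessboardCellGain.Checker

open Finset

/-! ### The real closed form -/

/-- The sign `(−1)^{t κ}` of a class / shift at axis `κ`. -/
noncomputable def sgn (t : Fin 4 → ZMod 2) (κ : Fin 4) : ℝ := (-1 : ℝ) ^ (t κ).val

/-- `sin² θ_κ = 1 − C_κ²`. -/
noncomputable def s2 (C : Fin 4 → ℝ) (κ : Fin 4) : ℝ := 1 - C κ ^ 2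

/-- The Wilson mass `A(σ) = Σ_κ (1 − σ_κ C_κ)` at the shifted momentum `θ + πσ` (mass `m = 0`). -/
noncomputable def aW (C : Fin 4 → ℝ) (σ : Fin 4 → ZMod 2) : ℝ := ∑ κ : Fin 4, (1 - sgn σ κ * C κ)

/-- The symbol denominator `h(σ) = A(σ)² + Σ_κ sin² θ_κ`. -/
noncomputable def hW (C : Fin 4 → ℝ) (σ : Fin 4 → ZMod 2) : ℝ := aW C σ ^ 2 + ∑ κ : Fin 4, s2 C κ

/-- The signed sum `W(s) = Σ_κ s_κ sin² θ_κ`. -/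
noncomputable def wS (C : Fin 4 → ℝ) (s : Fin 4 → ZMod 2) : ℝ := ∑ κ : Fin 4, sgn s κ * s2 C κ

/-- The traced bubble numerator `T(σ, s)_{μν}`. -/
noncomputable def tB (C : Fin 4 → ℝ) (σ s : Fin 4 → ZMod 2) (μ ν : Fin 4) : ℝ :=
  aW C σ * aW C (σ + s) * (sgn σ μ * C μ) * (sgn σ ν * C ν) - wS C s * (sgn σ μ * C μ) * (sgn σ ν * C ν)
    + (aW C σ - aW C (σ + s)) * (sgn σ μ * C μ * s2 C ν + sgn σ ν * C ν * s2 C μ) - 2 * s2 C μ * s2 C ν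
    + (if μ = ν then (-(aW C σ * aW C (σ + s)) - wS C s) * s2 C μ else 0)

/-- The real closed form of the block-Hessian entry `H(s)_{μν}` at block twist `C = cos θ` (active `μ, ν`):
tadpole `[μ=ν] Σ_σ 2(S2_μ − A(σ) σ_μ C_μ)/h(σ)` plus bubble `Σ_σ 2 T/(h(σ) h(σ+s))`. -/
noncomputable def blockHc (C : Fin 4 → ℝ) (s : Fin 4 → ZMod 2) (μ ν : Fin 4) : ℝ :=
  (if μ = ν then ∑ σ : Fin 4 → ZMod 2, 2 * (s2 C μ - aW C σ * (sgn σ μ * C μ)) / hW C σ else 0)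
    + ∑ σ : Fin 4 → ZMod 2, 2 * tB C σ s μ ν / (hW C σ * hW C (σ + s))

/-- Number of active axes of a Walsh class. -/
def nAct (s : Fin 4 → ZMod 2) : ℕ := (Finset.univ.filter fun μ : Fin 4 => s μ = 1).card

/-- The per-block margin statement at twist `C`, class `s`, constant `γ`: `64 γ n(s) |y|² ≤ yᵀ H(s) y` for every real
`y` supported on the active axes with `Σ y = 0` (a bookkeeping predicate of this file, not a cited fact). [folklore] -/
structure BlockMargin (γ : ℝ) (C : Fin 4 → ℝ) (s : Fin 4 → ZMod 2) : Prop where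
  /-- the quadratic-form inequality on `1^⊥` -/
  le : ∀ y : Fin 4 → ℝ, (∀ μ, s μ = 0 → y μ = 0) → ∑ μ, y μ = 0 →
    64 * γ * ((nAct s : ℝ) * ∑ μ, y μ ^ 2) ≤ ∑ μ, ∑ ν, blockHc C s μ ν * (y μ * y ν)

/-! ### Bit masks for Walsh classes and shifts -/

/-- The class / shift encoded by a bit mask: axis `κ` is active iff bit `κ` of `b` is set. -/
def bitsFun (b : ℕ) (κ : Fin 4) : ZMod 2 := if b.testBit κ.val then 1 else 0

/-- The list of active axes of a bit mask, increasing. -/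
def actList (b : ℕ) : List (Fin 4) := (List.finRange 4).filter fun κ => b.testBit κ.val

/-! ### The exact-rational per-block test (`LDLᵀ` on `Pᵀ X P`) -/

/-- `LDLᵀ` positivity test for a symmetric `k × k` rational kernel: pivot `> 0`, recurse on the Schur complement. -/
def ldlPos : (k : ℕ) → (ℕ → ℕ → ℚ) → Bool
  | 0, _ => true
  | k + 1, M =>
    let d := M 0 0
    decide (0 < d) && ldlPos k (fun i j => M (i + 1) (j + 1) - M (i + 1) 0 * M 0 (j + 1) / d)

/-- Symmetrised midpoint of entrywise enclosures `lo ≤ H ≤ hi`. -/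
def midM (lo hi : ℕ → ℕ → ℚ) (i j : ℕ) : ℚ := (lo i j + hi i j + lo j i + hi j i) / 4

/-- Symmetrised radius of entrywise enclosures `lo ≤ H ≤ hi`. -/
def radM (lo hi : ℕ → ℕ → ℚ) (i j : ℕ) : ℚ := (hi i j - lo i j + hi j i - lo j i) / 4

/-- Row sums of the symmetrised radius (structural recursion). -/
def rowR (n : ℕ) (lo hi : ℕ → ℕ → ℚ) (i : ℕ) : ℚ := (List.range n).foldr (fun j acc => radM lo hi i j + acc) 0

/-- `X = Hmid − 64 n γ − diag R`. -/
def XM (γ : ℚ) (n : ℕ) (lo hi : ℕ → ℕ → ℚ) (i j : ℕ) : ℚ :=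
  midM lo hi i j - if i = j then 64 * n * γ + rowR n lo hi i else 0

/-- `G = Pᵀ X P` for `P` with columns `e_i − e_{i+1}`. -/
def GM (X : ℕ → ℕ → ℚ) (i j : ℕ) : ℚ := X i j - X i (j + 1) - X (i + 1) j + X (i + 1) (j + 1)

/-- The per-block test from entrywise enclosures of an `n × n` block (`n ≥ 2`): `Pᵀ (Hmid − 64nγ − diag R) P ≻ 0`. -/
def blockOK (γ : ℚ) (n : ℕ) (lo hi : ℕ → ℕ → ℚ) : Bool := ldlPos (n - 1) (GM (XM γ n lo hi))

/-! ### Integer boxes at a binary scale and the bisection driver -/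

/-- An integer box: coordinate `k < 4` of the scaled twist satisfies `lo_k ≤ C_k · S ≤ hi_k`
(`(0, 0)` beyond the list). -/
abbrev IBox : Type := List (ℤ × ℤ)

namespace IBox

/-- The interval of coordinate `k`. -/
def ivl (B : IBox) (k : ℕ) : ℤ × ℤ := B.getD k (0, 0)

/-- Membership of a real point at scale `S` (a bookkeeping predicate of this file, not a cited fact). [folklore] -/
structure mem (S : ℕ) (B : IBox) (C : Fin 4 → ℝ) : Prop where
  /-- every coordinate lies in its scaled interval -/
  out : ∀ k : Fin 4, ((B.ivl k).1 : ℝ) ≤ C k * S ∧ C k * S ≤ ((B.ivl k).2 : ℝ)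

/-- Width of coordinate `k`. -/
def width (B : IBox) (k : ℕ) : ℤ := (B.ivl k).2 - (B.ivl k).1

/-- The widest of the four coordinates. -/
def widest (B : IBox) : ℕ :=
  let w0 := B.width 0
  let w1 := B.width 1
  let w2 := B.width 2
  let w3 := B.width 3
  if w0 < w1 then (if w1 < w2 then (if w2 < w3 then 3 else 2) else (if w1 < w3 then 3 else 1))
  else (if w0 < w2 then (if w2 < w3 then 3 else 2) else (if w0 < w3 then 3 else 0))

/-- Bisection of coordinate `k` at the integer midpoint (floor): `[lo, m]` and `[m, hi]`. -/
def split (B : IBox) (k : ℕ) : IBox × IBox :=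
  let I := B.ivl k
  let m := (I.1 + I.2) / 2
  (B.set k (I.1, m), B.set k (m, I.2))

/-- The box misses the sorted chamber `C₀ ≤ C₁ ≤ C₂ ≤ C₃`: some `hi_{k+1} < lo_k`. -/
def outsideSorted (B : IBox) : Bool :=
  decide ((B.ivl 1).2 < (B.ivl 0).1) || decide ((B.ivl 2).2 < (B.ivl 1).1) || decide ((B.ivl 3).2 < (B.ivl 2).1)

end IBox

/-- Fuel-bounded adaptive bisection: accept a box if it misses the sorted chamber or passes the leaf test,
otherwise bisect the widest coordinate. -/
def certify (leafOK : IBox → Bool) : ℕ → IBox → Bool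
  | 0, B => B.outsideSorted || leafOK B
  | f + 1, B => B.outsideSorted || leafOK B ||
      (certify leafOK f (B.split B.widest).1 && certify leafOK f (B.split B.widest).2)



/-! ### Symmetries and regions (definitions; lemmas in `…CheckerSymm.lean`) -/

/-- The reflected twist `C^τ_κ = τ_κ C_κ`. -/
noncomputable def reflectC (τ : Fin 4 → ZMod 2) (C : Fin 4 → ℝ) (κ : Fin 4) : ℝ := sgn τ κ * C κ

/-- The twist with axes relabelled by a permutation. -/
def permC {α : Type*} (π : Equiv.Perm (Fin 4)) (f : Fin 4 → α) : Fin 4 → α := fun κ => f (π κ)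

/-- The sign pattern that makes every coordinate nonnegative. -/
noncomputable def absPattern (C : Fin 4 → ℝ) (κ : Fin 4) : ZMod 2 := if C κ < 0 then 1 else 0

/-- Number of coordinates in the collar `|C_κ| > cos ½` (i.e. `min(θ_κ, π − θ_κ) < ½`). -/
noncomputable def nNear (C : Fin 4 → ℝ) : ℕ := (Finset.univ.filter fun κ : Fin 4 => Real.cos (1 / 2) < |C κ|).card

/-- Region `r ∈ {0, 1, 2}`: exactly `r` collar coordinates; region `3` (= P3a): at least three collar coordinates and
some coordinate outside the corner collar `|C_κ| > cos (1/20)`. All with `|C| ≤ 1`. [folklore] -/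
def InRegion (r : ℕ) (C : Fin 4 → ℝ) : Prop :=
  (∀ κ, |C κ| ≤ 1) ∧ (if r < 3 then nNear C = r else 3 ≤ nNear C ∧ ∃ κ, |C κ| ≤ Real.cos (1 / 20))


/-! ### Scale, thresholds and root boxes -/

/-- The binary scale `S = 2²⁰` of the integer boxes and of the affine forms. -/
def SC : ℕ := 1048576

/-- `⌈0.8783 · S⌉ ≥ cos ½ · S`: upper end of a bulk coordinate. -/
def K0 : ℤ := 920965

/-- `⌊0.8717 · S⌋ ≤ cos ½ · S`: lower end of a collar coordinate. -/
def K0m : ℤ := 914043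

/-- `⌈0.99875033 · S⌉ ≥ cos (1/20) · S`: upper end of a collar-but-not-corner coordinate. -/
def K2 : ℤ := 1047266

/-- The root boxes of the four regions in the sorted nonnegative chamber (coordinates ascending). -/
def roots : ℕ → List IBox
  | 0 => [[(0, K0), (0, K0), (0, K0), (0, K0)]]
  | 1 => [[(0, K0), (0, K0), (0, K0), (K0m, SC)]]
  | 2 => [[(0, K0), (0, K0), (K0m, SC), (K0m, SC)]]
  | _ => [[(0, K0), (K0m, SC), (K0m, SC), (K0m, SC)], [(K0m, K2), (K0m, SC), (K0m, SC), (K0m, SC)]]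


/-! ### Two elementary facts shipped with the definitions -/

/-- `T` is symmetric in `μ, ν`. -/
theorem tB_symm (C : Fin 4 → ℝ) (σ s : Fin 4 → ZMod 2) (μ ν : Fin 4) : tB C σ s μ ν = tB C σ s ν μ := by
  unfold tB
  by_cases h : μ = ν
  · subst h; rfl
  · simp only [h, Ne.symm h, if_false]; ring

/-- **The closed form is symmetric in `μ, ν`** (registered helper `stub_checkerBlockHcSymm`). -/
theorem stub_checkerBlockHcSymm : ∀ (C : Fin 4 → ℝ) (s : Fin 4 → ZMod 2) (μ ν : Fin 4), blockHc C s μ ν = blockHc C s ν μ := by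
  intro C s μ ν
  unfold blockHc
  by_cases h : μ = ν
  · subst h; rfl
  · simp only [h, Ne.symm h, if_false, tB_symm C _ s μ ν]

end Summit.QuantumFields.QCD.Cruxes.CriticalLineDiamagnetism.ChessboardCellGain.Checker
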